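import Summits.Ventures.CertifiedManyBodySolver.Downfold.RouterScoreAggregate

/-!
# Router-word score, part 4: HEADER verdict (the pen's R) vs ALL-COLUMNS verdict (score-2's ledger) for multi-P materials

Venture CertifiedManyBodySolver, cell `pub/hubbard-downfold`, seat hubbard-downfold-score-2 (session g8, 2026-08-27);
namespace `Summit.Ventures.CertifiedManyBodySolver.Downfold.RouterScore` (continues `RouterWordScore.lean` p462277 and
`RouterScoreAggregate.lean`). Finite, PROVED statements about two bookkeeping conventions; nothing here is physics.

WHAT THIS IS NOT: not the scorer of record and not a proposal to change it. It is the kernel record of the DESIGN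
DIFFERENCE registered in `validation/score/PREREG.md` §E (2026-08-27T04:5xZ) and printed by `router/live_parity.py`
(fea012d9): deputy-2's `score.py router_score` reads the map HEADER word list only (= the assembler's words at the first
pressure column, `header.router.words`), so a material's R verdict is the §4.2 outcome of its FIRST column
(`headerVerdict`); score-2's ledger scores every (material, P) cell and calls a material AGREE only if ALL its worded
columns agree (`allColumns`; `router_score.py summary` R_mat / `a10 --consequence`). PROVED: the two coincide whenever
all columns carry the same outcome (`allColumns_of_forall_eq`); an all-columns AGREE forces a header AGREE
(`header_agree_of_allColumns_agree`) — so a material the pen counts non-AGREE is non-AGREE for me too (R-NEUTRAL in that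
direction, `nonAgree_of_header_nonAgree`), while the converse fails (`headerAgree_allColumns_not` — a material AGREE at
P₀ and DISAGREE at a higher-P column counts for the pen and not for me); hence over any table my AGREE count is AT MOST
the pen's (`countAllAgree_le_countHeaderAgree`): the pen's R is an upper bound of the all-columns R. The one label
difference of RUN #13 (M86 Zr: header @0 PARTIAL, columns [PARTIAL, DISAGREE] ⇒ all-columns DISAGREE) is `zr_run13` —
non-AGREE under both, R-neutral.
-/

namespace Summit.Ventures.CertifiedManyBodySolver.Downfold

namespace RouterScore

/-! ## §1 The two material-level conventions over a material's per-column outcomes (first column first) -/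

/-- score-2's ALL-COLUMNS material verdict: any DISAGREE ⇒ DISAGREE; else all AGREE (non-empty) ⇒ AGREE; else any
PARTIAL ⇒ PARTIAL; else the first column's outcome (abstention kinds); no column ⇒ ABSTAIN_noWord. [folklore] -/
def allColumns (cols : List Outcome) : Outcome :=
  if Outcome.DISAGREE ∈ cols then .DISAGREE
  else if cols ≠ [] ∧ cols.all (fun o => decide (o = Outcome.AGREE)) then .AGREE
  else if Outcome.PARTIAL ∈ cols then .PARTIAL
  else cols.head?.getD .ABSTAIN_noWord

/-- the pen's HEADER verdict: the outcome of the first (header) column; no column ⇒ ABSTAIN_noWord. [folklore] -/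
def headerVerdict (cols : List Outcome) : Outcome := cols.head?.getD .ABSTAIN_noWord

/-! ## §2 Where they coincide and where not -/

/-- If every column carries the same outcome `o`, both conventions return `o`. [folklore] -/
theorem allColumns_of_forall_eq {cols : List Outcome} {o : Outcome} (hne : cols ≠ []) (h : ∀ c ∈ cols, c = o) :
    allColumns cols = o ∧ headerVerdict cols = o := by
  obtain ⟨c, tl, rfl⟩ := List.exists_cons_of_ne_nil hne
  have hc : c = o := h c (by simp)
  subst hc
  refine ⟨?_, by simp [headerVerdict]⟩
  have mem_eq : ∀ y, y ∈ c :: tl → y = c := h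
  have hall : ((c :: tl).all fun x => decide (x = Outcome.AGREE)) = true ↔ c = Outcome.AGREE := by
    simp only [List.all_eq_true, decide_eq_true_eq]
    exact ⟨fun H => H c (by simp), fun hc x hx => (mem_eq x hx).trans hc⟩
  unfold allColumns
  by_cases hD : c = Outcome.DISAGREE
  · subst hD; simp
  · have hnD : Outcome.DISAGREE ∉ c :: tl := fun hm => hD (mem_eq _ hm).symm
    rw [if_neg hnD]
    by_cases hA : c = Outcome.AGREE
    · rw [if_pos ⟨by simp, hall.mpr hA⟩, hA]
    · rw [if_neg (fun hx => hA (hall.mp hx.2))]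
      by_cases hP : c = Outcome.PARTIAL
      · subst hP; simp
      · have hnP : Outcome.PARTIAL ∉ c :: tl := fun hm => hP (mem_eq _ hm).symm
        rw [if_neg hnP]; simp

/-- single-column materials: the conventions are identical. [folklore] -/
theorem allColumns_singleton (o : Outcome) : allColumns [o] = headerVerdict [o] := by
  cases o <;> decide

/-- An all-columns AGREE forces the header column to be AGREE. [folklore] -/
theorem header_agree_of_allColumns_agree {cols : List Outcome} (h : allColumns cols = .AGREE) :
    headerVerdict cols = .AGREE := by
  unfold allColumns at h
  split_ifs at h with h1 h2 h3
  · obtain ⟨hne, hall⟩ := h2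
    obtain ⟨c, tl, rfl⟩ := List.exists_cons_of_ne_nil hne
    simp only [List.all_cons, Bool.and_eq_true, decide_eq_true_eq] at hall
    simp [headerVerdict, hall.1]
  · -- fell through to the head: then the head itself is AGREE
    cases cols with
    | nil => simp at h
    | cons c tl => simpa [headerVerdict] using h

/-- R-NEUTRAL direction: a material the pen counts as non-AGREE is non-AGREE in the all-columns ledger too. [folklore] -/
theorem nonAgree_of_header_nonAgree {cols : List Outcome} (h : headerVerdict cols ≠ .AGREE) :
    allColumns cols ≠ .AGREE := fun ha => h (header_agree_of_allColumns_agree ha)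

/-- … but NOT conversely: AGREE at the header column and DISAGREE at a higher-P column counts as AGREE for the pen and
as DISAGREE for the all-columns ledger — the registered case in which the two R figures differ BY DESIGN. [folklore] -/
theorem headerAgree_allColumns_not :
    headerVerdict [.AGREE, .DISAGREE] = .AGREE ∧ allColumns [.AGREE, .DISAGREE] = .DISAGREE := by decide

/-- the same with a PARTIAL higher-P column. [folklore] -/
theorem headerAgree_allColumns_partial :
    headerVerdict [.AGREE, .PARTIAL] = .AGREE ∧ allColumns [.AGREE, .PARTIAL] = .PARTIAL := by decide

/-- RUN #13 (maps/run-2026-08-27h) M86 Zr: header @0 «UND:MIXED+EPH» ⇒ PARTIAL; by_P @30 «UND:MULTIORB(k=2)» ⇒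
DISAGREE ⇒ all-columns DISAGREE — a LABEL difference only (non-AGREE under both). [folklore] -/
theorem zr_run13 : headerVerdict [.PARTIAL, .DISAGREE] = .PARTIAL ∧ allColumns [.PARTIAL, .DISAGREE] = .DISAGREE ∧
    headerVerdict [.PARTIAL, .DISAGREE] ≠ .AGREE ∧ allColumns [.PARTIAL, .DISAGREE] ≠ .AGREE := by decide

/-! ## §3 Over a table: the pen's AGREE count bounds the all-columns AGREE count from above -/

/-- number of materials (each = its list of column outcomes) a convention `f` calls AGREE. [folklore] -/
def countAgree (f : List Outcome → Outcome) (table : List (List Outcome)) : ℕ :=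
  (table.filter fun cols => decide (f cols = Outcome.AGREE)).length

/-- Over any table, all-columns AGREE materials ≤ header AGREE materials; hence (same denominator of worded materials)
the all-columns R never exceeds the pen's R. [folklore] -/
theorem countAllAgree_le_countHeaderAgree (table : List (List Outcome)) :
    countAgree allColumns table ≤ countAgree headerVerdict table := by
  induction table with
  | nil => simp [countAgree]
  | cons cols tl ih =>
    simp only [countAgree, List.filter_cons] at ih ⊢
    by_cases ha : allColumns cols = .AGREE
    · have hh := header_agree_of_allColumns_agree ha
      simp [ha, hh]; exact ih
    · by_cases hh : headerVerdict cols = .AGREE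
      · simp [ha, hh]; exact Nat.le_succ_of_le ih
      · simp [ha, hh]; exact ih

/-- … with equality when every material's columns are unanimous (e.g. every single-P material, and RUN #13's 23
multi-P materials except Zr, which is non-AGREE under both). [folklore] -/
theorem countAgree_eq_of_unanimous (table : List (List Outcome))
    (h : ∀ cols ∈ table, cols ≠ [] ∧ ∀ c ∈ cols, c = cols.head?.getD .ABSTAIN_noWord) :
    countAgree allColumns table = countAgree headerVerdict table := by
  induction table with
  | nil => rfl
  | cons cols tl ih =>
    have hc := h cols (by simp)
    have e := allColumns_of_forall_eq hc.1 hc.2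
    simp only [countAgree, List.filter_cons, e.1, e.2] at *
    have ih' := ih (fun c hc' => h c (by simp [hc']))
    split <;> simp [ih']

end RouterScore

end Summit.Ventures.CertifiedManyBodySolver.Downfold
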